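import Summits.QuantumFields.YangMills.Theorems.BalabanUVNodesN15KingModelHeatKernelSubordination
import Summits.QuantumFields.YangMills.Theorems.BalabanUVNodesN15KingModelHeatKernelProductMajorants
import HarnessLib

/-!
# BalabanUVNodes ∕ N15 — THE KING-MODEL RUNG (PART Ϣ-h): THE POWER-LAW DECAY OF KING's `A = 0` COVARIANCE ON THE CUBIC FOUR-TORUS —
# `c·|(c(−Δ)+m²)⁻¹(x,y)| ≤ 34016∕(1 + |v((x−y)_ν)|²) + 8c∕(m²K₀⁴)` for every coordinate `ν`, every `c > 0`, `m² > 0`, every side `K₀ ≥ 1` (absolute constants; the mass only in the zero mode)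
# (Track A, DAG node N15 = NE2; FAN-OUT v1.1 §N15 s3 «KING-MODEL RUNG … + what the curved case adds»; count-neutral)

HONEST FRAMING.  Count-neutral (cell `pub-ymgap`, seat `pub-ymgap-dag-n15-e` g55; `--supports stmt-QuantumFields-27247 --as helper` = K3ᴬ).  King's `A = 0` covariance `G = (c(−Δ)+m²)⁻¹` on the CUBIC
four-torus `(ℤ∕K₀)⁴` ((2.13) p.653 with `c = L²`; symbol (4.4) p.670; plane waves (4.35) p.674; the tree's `lapF (cM K₀) c m²` as in Ϯ-e).  THIS FILE closes PART Ϣ: by Ϣ-f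
`c·|G(x,y)| ≤ ∫₀^∞e^{−(m²∕c)s}Π_μ‖Q^{(K₀)}_s((x−y)_μ)‖ds`; split the time integral at `s = n²`, `n = |v((x−y)_ν)| ≥ 1` (King's reduced coordinate of the difference in direction `ν`):
on `(0, n²]` Ϣ-g's near majorant `17000∕n⁴` integrates to `17000∕n²`; on `(n², ∞)` Ϣ-g's far majorant `8∕K₀⁴ + 8∕s²` integrates to `8c∕(m²K₀⁴) + 8∕n²` (`∫e^{−(m²∕c)s}ds ≤ c∕m²` — the ONLY
use of the mass — and `∫_{n²}^∞s⁻²ds = 1∕n²`) ⟹ ★★★ **`mul_abs_lapF_inv_le_of_coord_ne_zero`** (`c|G(x,y)| ≤ 17008∕n² + 8c∕(m²K₀⁴)`); at `n = 0` (or any `x, y`) the split at `s = 1` gives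
★★ `mul_abs_lapF_inv_le_nine` (`c|G(x,y)| ≤ 9 + 8c∕(m²K₀⁴)` — Ϯ-e's `5∕4 + c∕(m²K₀⁴)` is the sharp diagonal form); together ★★★★ **`mul_abs_lapF_inv_le_powerLaw`**
(`c|G(x,y)| ≤ 34016∕(1 + |v((x−y)_ν)|²) + 8c∕(m²K₀⁴)` for EVERY `ν`) and ★★★★ **`mul_abs_lapF_inv_le_of_dist_le`** (`D ≤ |v((x−y)_ν)|` for some `ν` ⟹ `c|G(x,y)| ≤ 34016∕(1+D²) + 8c∕(m²K₀⁴)`).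
THE POINT (door t3⁶⁰ of the n15-e desk): this is the CLUSTER PROPERTY of King's covariance in units of the hopping, UNIFORM in `c∕m²` — at King's scaling `c = L²`, `K₀ = LM₀` (PART Ϣ-i) the zero
mode is `8∕(m²L²M₀⁴) ≤ 8∕m²·K₀⁻²` and the whole bound is `C(m)∕(1 + dist²)` for every `L`, every volume; Ε-d's decay `(2∕m²)e^{−κ_F·dist}` is `O(c∕m²)` and Ϯ-e's `5∕4 + c∕(m²K₀⁴)` does not decay —
this one is both η-uniform and decaying, and plugs into Ϯ-n's kernel-form decoupling `abs_log_det_covLapF_decoupling_of_kernel_le` BY NAME.  Constants crude (`34016`) and absolute;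
`d+1 = 4`, equal periods.  NOT Bałaban's (3.42); NOT the curved `G(U)`; NOT a node discharge (N15 of record untouched); nothing continuum ∕ ℝ⁴ ∕ OS ∕ mass gap ∕ Clay.
PRIOR TREE ART (by name): PARTS Ϣ-f (`mul_abs_lapF_inv_le_integral`, `integrableOn_heatMajorant`), Ϣ-g (`prod_norm_cycleHeat_le_near`, `prod_norm_cycleHeat_le_far`, `prod_norm_cycleHeat_le_one`); Ε-e∕Ϯ-e
(the diagonal); Mathlib `integral_Ioi_rpow_of_lt`, `integrableOn_Ioi_rpow_of_lt`, `exp_neg_integrableOn_Ioi`, `setIntegral_mono_on`, `setIntegral_mono_set`, `setIntegral_const`, `Real.volume_real_Ioc`;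
the splitting `∫_{(0,∞)} = ∫_{(0,T]} + ∫_{(T,∞)}` is the tree's `LaceExpansionGaussianLemmaAssembly.integral_Ioi_eq_Ioc_add_Ioi_real` (Hara's §2.6 split) — stated here from a general left
endpoint (`setIntegral_Ioi_eq_Ioc_add_Ioi`), the lace-expansion tower not imported.
Dedup (rg at filing): basename 0 files; needles `setIntegral_Ioi_eq_Ioc_add_Ioi|integral_Ioi_exp_neg_mul_le_inv|integral_Ioi_inv_sq_eq|mul_abs_lapF_inv_le_of_coord_ne_zero|mul_abs_lapF_inv_le_nine|mul_abs_lapF_inv_le_powerLaw|mul_abs_lapF_inv_le_of_dist_le` 0 tree files.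
Locators: [King1986] (2.13) p.653, (4.4) p.670, (4.35) p.674; [Hara2008] §2.1 (2.1), §2.6 (the split of the time integral); [LawlerLimic2010] Thm 4.3.1 (Green's function `≍ |x|^{2−d}`, here `d = 4`, upper
bound only, on the finite torus, with the zero mode).  0 `sorry`, 0 `def`.
-/

noncomputable section

open Real Set Finset MeasureTheory
open scoped BigOperators

namespace Summit.QuantumFields.YangMills.BalabanUVNodes.N15KingModelRung.HeatKernel

open Literature.MathematicalPhysics.QuantumFieldTheory.Balaban1983to89.B5Prop11Plancherel (Tor)
open Literature.MathematicalPhysics.QuantumFieldTheory.Balaban1983to89.Beta.WoodburyFibre (cM)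
open Literature.MathematicalPhysics.QuantumFieldTheory.King1986.Torus (lapF)

/-! ## §1 Three facts about integrals over `(T, ∞)` -/

/-- Splitting `∫_{(a,∞)} = ∫_{(a,T]} + ∫_{(T,∞)}` for `a ≤ T` (cf. the tree's `LaceExpansionGaussianLemmaAssembly.integral_Ioi_eq_Ioc_add_Ioi_real` at `a = 0`). [cite: Hara2008, §2.6] -/
theorem setIntegral_Ioi_eq_Ioc_add_Ioi {f : ℝ → ℝ} {a T : ℝ} (hf : IntegrableOn f (Ioi a)) (haT : a ≤ T) :
    ∫ t in Ioi a, f t = (∫ t in Ioc a T, f t) + ∫ t in Ioi T, f t := by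
  rw [← setIntegral_union Set.Ioc_disjoint_Ioi_same measurableSet_Ioi (hf.mono_set Ioc_subset_Ioi_self) (hf.mono_set (Ioi_subset_Ioi haT)),
    Ioc_union_Ioi_eq_Ioi haT]

/-- `∫_{(T,∞)} e^{−μs}ds ≤ 1∕μ` for `μ > 0`, `T ≥ 0`. [folklore] -/
theorem integral_Ioi_exp_neg_mul_le_inv {μ0 T : ℝ} (hμ : 0 < μ0) (hT : 0 ≤ T) : ∫ s in Ioi T, Real.exp (-(μ0 * s)) ≤ μ0⁻¹ := by
  have hint : IntegrableOn (fun s : ℝ => Real.exp (-(μ0 * s))) (Ioi 0) := by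
    have := exp_neg_integrableOn_Ioi 0 hμ
    exact this.congr_fun (fun t _ => by ring_nf) measurableSet_Ioi
  have h1 : ∫ s in Ioi T, Real.exp (-(μ0 * s)) ≤ ∫ s in Ioi (0 : ℝ), Real.exp (-(μ0 * s)) :=
    setIntegral_mono_set hint (Filter.Eventually.of_forall fun s => (Real.exp_pos _).le) (Filter.Eventually.of_forall (Ioi_subset_Ioi hT))
  have h2 : ∫ s in Ioi (0 : ℝ), Real.exp (-(μ0 * s)) = μ0⁻¹ := by
    have h := integral_exp_neg_mul_Ioi_eq_inv hμ
    rw [← h]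
    exact integral_congr_ae (Filter.Eventually.of_forall fun t => by ring_nf)
  linarith

/-- `∫_{(T,∞)} s⁻² ds = 1∕T` for `T > 0` (Mathlib `integral_Ioi_rpow_of_lt` at exponent `−2`). [folklore] -/
theorem integral_Ioi_inv_sq_eq {T : ℝ} (hT : 0 < T) : ∫ s in Ioi T, 1 / s ^ 2 = 1 / T := by
  have h := integral_Ioi_rpow_of_lt (a := -2) (by norm_num) hT
  have hcongr : ∫ s in Ioi T, 1 / s ^ 2 = ∫ s in Ioi T, s ^ (-2 : ℝ) := by
    refine setIntegral_congr_fun measurableSet_Ioi fun s hs => ?_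
    have hs0 : 0 ≤ s := le_of_lt (lt_trans hT hs)
    rw [show (-2 : ℝ) = -(2 : ℝ) by norm_num, Real.rpow_neg hs0, Real.rpow_two, one_div]
  rw [hcongr, h]
  rw [show (-2 : ℝ) + 1 = -1 by norm_num, Real.rpow_neg_one]
  field_simp

/-- Integrability of `s⁻²` on `(T, ∞)`, `T > 0`. [folklore] -/
theorem integrableOn_inv_sq_Ioi {T : ℝ} (hT : 0 < T) : IntegrableOn (fun s : ℝ => 1 / s ^ 2) (Ioi T) := by
  have h := integrableOn_Ioi_rpow_of_lt (a := -2) (by norm_num) hT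
  refine h.congr_fun (fun s hs => ?_) measurableSet_Ioi
  have hs0 : 0 ≤ s := le_of_lt (lt_trans hT hs)
  show s ^ (-2 : ℝ) = 1 / s ^ 2
  rw [show (-2 : ℝ) = -(2 : ℝ) by norm_num, Real.rpow_neg hs0, Real.rpow_two, one_div]

/-! ## §2 The two regions of the time integral on the cubic four-torus -/

variable {K₀ : ℕ} [NeZero K₀] {c m2 : ℝ}

/-- The subordination majorant of PART Ϣ-f on the cubic torus: `F(s) = e^{−(m²∕c)s}·Π_μ‖Q^{(K₀)}_s(z_μ)‖`, integrable on `(0,∞)`. [cite: King1986, (4.4) p.670] -/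
theorem integrableOn_majorant_cM (hc : 0 < c) (hm : 0 < m2) (z : Tor (cM K₀)) :
    IntegrableOn (fun s : ℝ => Real.exp (-(m2 / c * s)) * ∏ μ : Fin 4, ‖cycleHeat K₀ s (z μ)‖) (Ioi 0) :=
  integrableOn_heatMajorant (cM K₀) (div_pos hm hc) z

/-- ★ REGION II: `∫_{(T,∞)} e^{−(m²∕c)s}Π_μ‖Q_s(z_μ)‖ds ≤ 8c∕(m²K₀⁴) + 8∕T` for `T > 0`. [cite: King1986, (2.13) p.653, (4.4) p.670, (4.35) p.674] -/
theorem integral_far_le (hc : 0 < c) (hm : 0 < m2) (z : Tor (cM K₀)) {T : ℝ} (hT : 0 < T) :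
    ∫ s in Ioi T, Real.exp (-(m2 / c * s)) * ∏ μ : Fin 4, ‖cycleHeat K₀ s (z μ)‖ ≤ 8 * c / (m2 * (K₀ : ℝ) ^ 4) + 8 / T := by
  have hK : (0 : ℝ) < K₀ := by exact_mod_cast Nat.pos_of_ne_zero (NeZero.ne K₀)
  have hμ : 0 < m2 / c := div_pos hm hc
  have hF := (integrableOn_majorant_cM hc hm z).mono_set (Ioi_subset_Ioi hT.le)
  have hE : IntegrableOn (fun s : ℝ => Real.exp (-(m2 / c * s))) (Ioi T) := by
    have := exp_neg_integrableOn_Ioi T hμ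
    exact this.congr_fun (fun t _ => by ring_nf) measurableSet_Ioi
  have hG : IntegrableOn (fun s : ℝ => 8 / (K₀ : ℝ) ^ 4 * Real.exp (-(m2 / c * s)) + 8 * (1 / s ^ 2)) (Ioi T) :=
    (hE.const_mul _).add ((integrableOn_inv_sq_Ioi hT).const_mul _)
  have hpt : ∀ s ∈ Ioi T, Real.exp (-(m2 / c * s)) * ∏ μ : Fin 4, ‖cycleHeat K₀ s (z μ)‖
      ≤ 8 / (K₀ : ℝ) ^ 4 * Real.exp (-(m2 / c * s)) + 8 * (1 / s ^ 2) := by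
    intro s hs
    have hs0 : 0 < s := lt_trans hT hs
    have hfar := prod_norm_cycleHeat_le_far (K₀ := K₀) hs0 z
    have he1 : Real.exp (-(m2 / c * s)) ≤ 1 := by rw [Real.exp_le_one_iff]; exact neg_nonpos.mpr (by positivity)
    have he0 : 0 ≤ Real.exp (-(m2 / c * s)) := (Real.exp_pos _).le
    have hp0 : 0 ≤ 8 / s ^ 2 := by positivity
    calc Real.exp (-(m2 / c * s)) * ∏ μ : Fin 4, ‖cycleHeat K₀ s (z μ)‖ ≤ Real.exp (-(m2 / c * s)) * (8 / (K₀ : ℝ) ^ 4 + 8 / s ^ 2) :=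
          mul_le_mul_of_nonneg_left hfar he0
      _ = 8 / (K₀ : ℝ) ^ 4 * Real.exp (-(m2 / c * s)) + Real.exp (-(m2 / c * s)) * (8 / s ^ 2) := by ring
      _ ≤ 8 / (K₀ : ℝ) ^ 4 * Real.exp (-(m2 / c * s)) + 1 * (8 / s ^ 2) := by gcongr
      _ = 8 / (K₀ : ℝ) ^ 4 * Real.exp (-(m2 / c * s)) + 8 * (1 / s ^ 2) := by ring
  have hmono := setIntegral_mono_on hF hG measurableSet_Ioi hpt
  have hsplit : ∫ s in Ioi T, (8 / (K₀ : ℝ) ^ 4 * Real.exp (-(m2 / c * s)) + 8 * (1 / s ^ 2))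
      = 8 / (K₀ : ℝ) ^ 4 * (∫ s in Ioi T, Real.exp (-(m2 / c * s))) + 8 * ∫ s in Ioi T, 1 / s ^ 2 := by
    rw [integral_add (hE.const_mul _) ((integrableOn_inv_sq_Ioi hT).const_mul _), integral_const_mul, integral_const_mul]
  rw [hsplit, integral_Ioi_inv_sq_eq hT] at hmono
  have hexp := integral_Ioi_exp_neg_mul_le_inv hμ hT.le
  have h8T : 8 * (1 / T) = 8 / T := by ring
  rw [h8T] at hmono
  have hzm : 8 / (K₀ : ℝ) ^ 4 * (∫ s in Ioi T, Real.exp (-(m2 / c * s))) ≤ 8 * c / (m2 * (K₀ : ℝ) ^ 4) := by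
    calc 8 / (K₀ : ℝ) ^ 4 * (∫ s in Ioi T, Real.exp (-(m2 / c * s))) ≤ 8 / (K₀ : ℝ) ^ 4 * (m2 / c)⁻¹ := mul_le_mul_of_nonneg_left hexp (by positivity)
      _ = 8 * c / (m2 * (K₀ : ℝ) ^ 4) := by field_simp
  linarith

/-- ★ REGION I: for `z_ν ≠ 0` and `n = |v(z_ν)|`, `∫_{(0,n²]} e^{−(m²∕c)s}Π_μ‖Q_s(z_μ)‖ds ≤ 17000∕n²`. [cite: King1986, (2.13) p.653, (4.4) p.670, (4.35) p.674] -/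
theorem integral_near_le (hc : 0 < c) (hm : 0 < m2) (z : Tor (cM K₀)) (ν : Fin 4) (hν : z ν ≠ 0) :
    ∫ s in Ioc (0 : ℝ) ((((z ν).valMinAbs.natAbs : ℕ) : ℝ) ^ 2), Real.exp (-(m2 / c * s)) * ∏ μ : Fin 4, ‖cycleHeat K₀ s (z μ)‖
      ≤ 17000 / (((z ν).valMinAbs.natAbs : ℕ) : ℝ) ^ 2 := by
  set n : ℝ := (((z ν).valMinAbs.natAbs : ℕ) : ℝ) with hn
  have hnat : 1 ≤ (z ν).valMinAbs.natAbs := by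
    rw [Nat.one_le_iff_ne_zero, Ne, Int.natAbs_eq_zero, ZMod.valMinAbs_eq_zero]; exact hν
  have hn1 : (1 : ℝ) ≤ n := by rw [hn]; exact_mod_cast hnat
  have hn0 : 0 < n := by linarith
  have hT : 0 < n ^ 2 := by positivity
  have hF := (integrableOn_majorant_cM hc hm z).mono_set (Ioc_subset_Ioi_self : Ioc (0 : ℝ) (n ^ 2) ⊆ Ioi 0)
  have hG : IntegrableOn (fun _ : ℝ => 17000 / n ^ 4) (Ioc (0 : ℝ) (n ^ 2)) := integrableOn_const (by simp [Real.volume_Ioc])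
  have hpt : ∀ s ∈ Ioc (0 : ℝ) (n ^ 2), Real.exp (-(m2 / c * s)) * ∏ μ : Fin 4, ‖cycleHeat K₀ s (z μ)‖ ≤ 17000 / n ^ 4 := by
    intro s hs
    have hnear := prod_norm_cycleHeat_le_near (K₀ := K₀) hs.1 z ν hν hs.2
    have he1 : Real.exp (-(m2 / c * s)) ≤ 1 := by rw [Real.exp_le_one_iff]; exact neg_nonpos.mpr (by have := hs.1; positivity)
    have he0 : 0 ≤ Real.exp (-(m2 / c * s)) := (Real.exp_pos _).le
    have hp0 : 0 ≤ ∏ μ : Fin 4, ‖cycleHeat K₀ s (z μ)‖ := Finset.prod_nonneg fun μ _ => norm_nonneg _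
    calc Real.exp (-(m2 / c * s)) * ∏ μ : Fin 4, ‖cycleHeat K₀ s (z μ)‖ ≤ 1 * (17000 / n ^ 4) := mul_le_mul he1 hnear hp0 zero_le_one
      _ = 17000 / n ^ 4 := one_mul _
  have hmono := setIntegral_mono_on hF hG measurableSet_Ioc hpt
  rw [setIntegral_const, Real.volume_real_Ioc, max_eq_left (by linarith), sub_zero, smul_eq_mul] at hmono
  calc _ ≤ n ^ 2 * (17000 / n ^ 4) := hmono
    _ = 17000 / n ^ 2 := by field_simp

/-! ## §3 The power law -/

/-- ★★★ **`c·|G(x,y)| ≤ 17008∕|v((x−y)_ν)|² + 8c∕(m²K₀⁴)`** whenever `(x−y)_ν ≠ 0` (`c > 0`, `m² > 0`, cubic four-torus of side `K₀ ≥ 1`): PART Ϣ-f's time integral split at `s = |v|²`.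
[cite: King1986, (2.13) p.653, (4.4) p.670, (4.35) p.674; Hara2008, §2.1 (2.1)] -/
theorem mul_abs_lapF_inv_le_of_coord_ne_zero (hc : 0 < c) (hm : 0 < m2) (x y : Tor (cM K₀)) (ν : Fin 4) (hν : (x - y) ν ≠ 0) :
    c * |(lapF (cM K₀) c m2)⁻¹ x y| ≤ 17008 / ((((x - y) ν).valMinAbs.natAbs : ℕ) : ℝ) ^ 2 + 8 * c / (m2 * (K₀ : ℝ) ^ 4) := by
  set n : ℝ := ((((x - y) ν).valMinAbs.natAbs : ℕ) : ℝ) with hn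
  have hnat : 1 ≤ ((x - y) ν).valMinAbs.natAbs := by
    rw [Nat.one_le_iff_ne_zero, Ne, Int.natAbs_eq_zero, ZMod.valMinAbs_eq_zero]; exact hν
  have hn1 : (1 : ℝ) ≤ n := by rw [hn]; exact_mod_cast hnat
  have hT : 0 < n ^ 2 := by positivity
  have h0 := mul_abs_lapF_inv_le_integral (cM K₀) hc hm x y
  have hsplit := setIntegral_Ioi_eq_Ioc_add_Ioi (integrableOn_majorant_cM hc hm (x - y)) hT.le
  have h1 := integral_near_le hc hm (x - y) ν hν
  have h2 := integral_far_le hc hm (x - y) hT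
  have e8 : 8 / n ^ 2 + 17000 / n ^ 2 = 17008 / n ^ 2 := by ring
  calc c * |(lapF (cM K₀) c m2)⁻¹ x y| ≤ ∫ s in Ioi (0 : ℝ), Real.exp (-(m2 / c * s)) * ∏ μ : Fin 4, ‖cycleHeat K₀ s ((x - y) μ)‖ := h0
    _ = (∫ s in Ioc (0 : ℝ) (n ^ 2), Real.exp (-(m2 / c * s)) * ∏ μ : Fin 4, ‖cycleHeat K₀ s ((x - y) μ)‖)
          + ∫ s in Ioi (n ^ 2), Real.exp (-(m2 / c * s)) * ∏ μ : Fin 4, ‖cycleHeat K₀ s ((x - y) μ)‖ := hsplit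
    _ ≤ 17000 / n ^ 2 + (8 * c / (m2 * (K₀ : ℝ) ^ 4) + 8 / n ^ 2) := add_le_add h1 h2
    _ = 17008 / n ^ 2 + 8 * c / (m2 * (K₀ : ℝ) ^ 4) := by ring

/-- ★★ The diagonal-type bound for ALL `x, y`: `c·|G(x,y)| ≤ 9 + 8c∕(m²K₀⁴)` (split at `s = 1`; Ϯ-e's `5∕4 + c∕(m²K₀⁴)` is the sharp form at coinciding points). [cite: King1986, (2.13) p.653, (4.4) p.670, (4.35) p.674] -/
theorem mul_abs_lapF_inv_le_nine (hc : 0 < c) (hm : 0 < m2) (x y : Tor (cM K₀)) :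
    c * |(lapF (cM K₀) c m2)⁻¹ x y| ≤ 9 + 8 * c / (m2 * (K₀ : ℝ) ^ 4) := by
  have h0 := mul_abs_lapF_inv_le_integral (cM K₀) hc hm x y
  have hint := integrableOn_majorant_cM hc hm (x - y)
  have hsplit := setIntegral_Ioi_eq_Ioc_add_Ioi hint (zero_le_one : (0 : ℝ) ≤ 1)
  have h2 := integral_far_le hc hm (x - y) (zero_lt_one : (0 : ℝ) < 1)
  -- on `(0,1]` the integrand is `≤ 1`
  have hF := hint.mono_set (Ioc_subset_Ioi_self : Ioc (0 : ℝ) 1 ⊆ Ioi 0)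
  have hG : IntegrableOn (fun _ : ℝ => (1 : ℝ)) (Ioc (0 : ℝ) 1) := integrableOn_const (by simp [Real.volume_Ioc])
  have hpt : ∀ s ∈ Ioc (0 : ℝ) 1, Real.exp (-(m2 / c * s)) * ∏ μ : Fin 4, ‖cycleHeat K₀ s ((x - y) μ)‖ ≤ 1 := by
    intro s hs
    have he1 : Real.exp (-(m2 / c * s)) ≤ 1 := by rw [Real.exp_le_one_iff]; exact neg_nonpos.mpr (by have := hs.1; positivity)
    have hp := prod_norm_cycleHeat_le_one (K₀ := K₀) hs.1.le (x - y)
    have hp0 : 0 ≤ ∏ μ : Fin 4, ‖cycleHeat K₀ s ((x - y) μ)‖ := Finset.prod_nonneg fun μ _ => norm_nonneg _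
    calc _ ≤ 1 * (1 : ℝ) := mul_le_mul he1 hp hp0 zero_le_one
      _ = 1 := one_mul _
  have h1 := setIntegral_mono_on hF hG measurableSet_Ioc hpt
  rw [setIntegral_const, Real.volume_real_Ioc, max_eq_left (by norm_num), sub_zero, smul_eq_mul, mul_one] at h1
  rw [hsplit] at h0
  linarith

/-- ★★★★ **THE POWER LAW, UNIFIED**: for every coordinate `ν`, `c·|(lapF (cM K₀) c m²)⁻¹(x,y)| ≤ 34016∕(1 + |v((x−y)_ν)|²) + 8c∕(m²K₀⁴)` (`c > 0`, `m² > 0`, every `K₀ ≥ 1`, every `x, y`) — King's `A = 0`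
covariance in units of the hopping decays like the inverse square of the torus distance, UNIFORMLY IN `c∕m²`, plus the zero-mode share `8c∕(m²|T|)`.
[cite: King1986, (2.13) p.653, (4.4) p.670, (4.35) p.674; Balaban1984PropagatorsI, (1.29) p.23] -/
theorem mul_abs_lapF_inv_le_powerLaw (hc : 0 < c) (hm : 0 < m2) (x y : Tor (cM K₀)) (ν : Fin 4) :
    c * |(lapF (cM K₀) c m2)⁻¹ x y| ≤ 34016 / (1 + ((((x - y) ν).valMinAbs.natAbs : ℕ) : ℝ) ^ 2) + 8 * c / (m2 * (K₀ : ℝ) ^ 4) := by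
  by_cases hν : (x - y) ν = 0
  · have h := mul_abs_lapF_inv_le_nine hc hm x y
    have h0 : ((((x - y) ν).valMinAbs.natAbs : ℕ) : ℝ) = 0 := by
      rw [hν, ZMod.valMinAbs_zero]; simp
    rw [h0]
    norm_num
    linarith
  · have h := mul_abs_lapF_inv_le_of_coord_ne_zero hc hm x y ν hν
    set n : ℝ := ((((x - y) ν).valMinAbs.natAbs : ℕ) : ℝ) with hn
    have hnat : 1 ≤ ((x - y) ν).valMinAbs.natAbs := by
      rw [Nat.one_le_iff_ne_zero, Ne, Int.natAbs_eq_zero, ZMod.valMinAbs_eq_zero]; exact hν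
    have hn1 : (1 : ℝ) ≤ n := by rw [hn]; exact_mod_cast hnat
    have hkey : 17008 / n ^ 2 ≤ 34016 / (1 + n ^ 2) := by
      rw [div_le_div_iff₀ (by positivity) (by positivity)]
      nlinarith
    linarith

/-- ★★★★ **… IN TERMS OF A LOWER BOUND ON THE TORUS DISTANCE**: if `D ≤ |v((x−y)_ν)|` for some coordinate `ν` (e.g. the torus sup-distance of `x, y` is `≥ D`), then
`c·|(lapF (cM K₀) c m²)⁻¹(x,y)| ≤ 34016∕(1 + D²) + 8c∕(m²K₀⁴)` — the form consumed by Ϯ-n's kernel-form decoupling. [cite: King1986, (2.13) p.653, (4.4) p.670, (4.35) p.674] -/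
theorem mul_abs_lapF_inv_le_of_dist_le (hc : 0 < c) (hm : 0 < m2) (x y : Tor (cM K₀)) {D : ℝ} (hD0 : 0 ≤ D)
    (hD : ∃ ν : Fin 4, D ≤ ((((x - y) ν).valMinAbs.natAbs : ℕ) : ℝ)) :
    c * |(lapF (cM K₀) c m2)⁻¹ x y| ≤ 34016 / (1 + D ^ 2) + 8 * c / (m2 * (K₀ : ℝ) ^ 4) := by
  obtain ⟨ν, hν⟩ := hD
  refine (mul_abs_lapF_inv_le_powerLaw hc hm x y ν).trans (add_le_add ?_ le_rfl)
  apply div_le_div_of_nonneg_left (by norm_num) (by positivity)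
  nlinarith

end Summit.QuantumFields.YangMills.BalabanUVNodes.N15KingModelRung.HeatKernel

end
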